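import Literature.NumberTheory.Automorphic.RegularOrbitChartProductNonarch   -- ★ `exists_openPartialHomeomorph_conjOrbit` (product-form regular orbit chart on `M_n(F)`)
import Literature.NumberTheory.Automorphic.LocalStableConjSplitPlace        -- ★ `localSplitEquiv : U(H)(L⁺_v) ≃ₜ* GL_N(L_w)` at a split place, `coe_localSplitEquiv_apply`
import Literature.NumberTheory.Automorphic.AdelicUnitaryGroupDatum          -- ★ `cmDatum`, `map_cmConjRingHom_eq_map_complexConj`, `isUnit_placeForm_of_isUnit_det`
import Literature.NumberTheory.Rogawski1990.LocalTransfer                    -- ★ `IsRegularElt`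
import Literature.Algebra.Polynomial.SeparablePi                            -- ★ `separable_iff_forall_map_evalRingHom`
import HarnessLib

/-!
# Crux `H413` — K2-LIT E3 «EllipticInputs», U12-h engine L1 (split places and `GL_n`): CONJUGATES OF NEARBY CENTRALISER POINTS BY SMALL ELEMENTS FORM A
# NEIGHBOURHOOD of a regular semisimple element — in `GL_n(F)` over a complete non-archimedean field, and in `U_N(H)(L⁺_v)` at a SPLIT place

Cell `hodgecm-mathlib`, Track B «K2-LIT», crux item `stmt-HodgeConjecture-24833` (h413), line `K2_E3_EllipticInputs`, socket U12-h `sig_K2E3CharLocConstNearRegular` (‹#9L›);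
file L1-split of the memo `K2/K2E3-p09/g0/MEMO-U12h-9L-interface.v2.K2E3-p09-g0.md` (seat K2E3-p09 (g0)), twin of ★ `K2E3RegularConjugationOpenNonsplit` (p855243).
`--supports stmt-HodgeConjecture-24833 --as helper`.  THEOREMS ONLY — no `def`, no named fact, no instance, no notation, no `sorry`.  HONEST LABEL: HC_CM is proved only
modulo the 7 printed citations (2 remaining named inputs: hLiu418 = stmt-HodgeConjecture-24832, h413 = stmt-HodgeConjecture-24833) until rung 0 closes; count-neutral engine.

THE MATHEMATICS [HarishChandra1970, Part I §3 Lemma 20].  ★ `exists_openPartialHomeomorph_conjOrbit` (F0P3a road D-N6s, chart-B): for `A ∈ M_n(F)` with separable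
characteristic polynomial, `e(X, Y) = (1 + X)(A + Y)(1 + X)⁻¹` is an `OpenPartialHomeomorph` from `𝔪 × 𝔠` (`𝔠 = C(A)` the commutant) to `M_n(F)` near `(0, 0) ↦ A`.  Hence
(§1) for `γ ∈ GL_n(F)` regular semisimple and any neighbourhoods `W ∋ 1`, `O ∋ γ` in `GL_n(F)`: `{x t x⁻¹ : x ∈ W, t ∈ Z(γ) ∩ O} ∈ 𝓝 γ` — push the neighbourhood
`e.source ∩ {1 + X ∈ W} ∩ {A + Y ∈ O}` of `(0,0)` through `e` and pull back along the open embedding `GL_n(F) ↪ M_n(F)` (Mathlib `Units.isOpenEmbedding_val`; `A + Y`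
commutes with `A` for `Y ∈ C(A)`).  (§2) At a place `v` of `L⁺` SPLIT in `L` (`w ∣ v`, `w̄ ≠ w`), transport along ★ `localSplitEquiv : U(H)(L⁺_v) ≃ₜ* GL_N(L_w)` (regularity =
separability of the `w`-component, ★ `separable_iff_forall_map_evalRingHom`) gives the same statement on `(cmDatum L N H).Local v` — with ★ p855243 this is L1 at
EVERY finite place, every `N`.

* §1 **`conj_centralizer_mem_nhds_gl`** (field level, `GL_n(F)`);  §2 **`conj_torus_mem_nhds_of_isRegularElt_split`** (`U_N(H)(L⁺_v)`, split `v`).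

## References
* [HarishChandra1970] Harish-Chandra (notes by G. van Dijk), *Harmonic Analysis on Reductive p-adic Groups*, LNM 162 (1970), Part I §3 Lemma 20.
* [Borel1991] A. Borel, *Linear Algebraic Groups*, 2nd ed. (1991), I.4 (4.2, 4.4).
* [Rogawski1990] J. D. Rogawski, *Automorphic Representations of Unitary Groups in Three Variables*, Ann. of Math. Stud. 123 (1990), §3.1 p. 19, §4.9 p. 54.
-/

set_option autoImplicit false
-- the mandated namespace repeats `HodgeConjecture.HodgeConjecture`, as in every `Theorems/*.lean` of this sub-problem
set_option linter.dupNamespace false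

noncomputable section

open Set Filter Topology
open scoped Matrix.Norms.Operator Matrix MatrixGroups Pointwise

namespace Summit.HodgeConjecture.HodgeConjecture.Cruxes.H413.K2E3RegularConjugationOpenSplit

/-! ## §1 `GL_n(F)`, `F` a complete non-trivially normed field of characteristic zero -/

section GLn

variable {F : Type*} [NontriviallyNormedField F] [CompleteSpace F] [CharZero F] {n : Type*} [Fintype n] [DecidableEq n]

/-- **SMALL CONJUGATES OF NEARBY CENTRALISER POINTS FORM A NEIGHBOURHOOD OF A REGULAR SEMISIMPLE `γ ∈ GL_n(F)`**: for every neighbourhood `W` of `1` and `O` of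
`γ`, `{x t x⁻¹ : x ∈ W, t ∈ Z(γ), t ∈ O} ∈ 𝓝 γ` (★ `exists_openPartialHomeomorph_conjOrbit` pushed through Mathlib's open embedding `GL_n(F) ↪ M_n(F)`).
[cite: HarishChandra1970, Part I §3 Lemma 20] [cite: Borel1991, I.4 (4.2, 4.4)] -/
theorem conj_centralizer_mem_nhds_gl (γ : GL n F) (hγ : ((γ : Matrix n n F).charpoly).Separable)
    {W : Set (GL n F)} (hW : W ∈ 𝓝 (1 : GL n F)) {O : Set (GL n F)} (hO : O ∈ 𝓝 γ) :
    {g : GL n F | ∃ x ∈ W, ∃ t : GL n F, t ∈ Subgroup.centralizer ({γ} : Set (GL n F)) ∧ t ∈ O ∧ g = x * t * x⁻¹} ∈ 𝓝 γ := by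
  haveI : @CompleteSpace (Matrix n n F) PseudoMetricSpace.toUniformSpace := FiniteDimensional.complete F (Matrix n n F)
  have hemb : IsOpenEmbedding (Units.val : GL n F → Matrix n n F) := Units.isOpenEmbedding_val
  -- the slice `𝔪` and the commutant `𝔠` of `A = γ`
  set 𝔪 := LinearMap.range (LinearMap.mulLeft F (γ : Matrix n n F) - LinearMap.mulRight F (γ : Matrix n n F) : Module.End F (Matrix n n F)) with h𝔪
  set 𝔠 := LinearMap.ker (LinearMap.mulLeft F (γ : Matrix n n F) - LinearMap.mulRight F (γ : Matrix n n F) : Module.End F (Matrix n n F)) with h𝔠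
  obtain ⟨e, h0, -, he⟩ := Literature.NumberTheory.Automorphic.exists_openPartialHomeomorph_conjOrbit (γ : Matrix n n F) hγ
  -- the two coordinate maps `p ↦ 1 + X`, `p ↦ A + Y` and the neighbourhood of `(0, 0)` they cut out
  have hWm : Units.val '' W ∈ 𝓝 ((1 : GL n F) : Matrix n n F) := hemb.image_mem_nhds.2 hW
  have hOm : Units.val '' O ∈ 𝓝 ((γ : GL n F) : Matrix n n F) := hemb.image_mem_nhds.2 hO
  have hc1 : Continuous fun p : ↥𝔪 × ↥𝔠 => (1 : Matrix n n F) + (p.1 : Matrix n n F) :=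
    continuous_const.add (𝔪.subtype.continuous_of_finiteDimensional.comp continuous_fst)
  have hc2 : Continuous fun p : ↥𝔪 × ↥𝔠 => (γ : Matrix n n F) + (p.2 : Matrix n n F) :=
    continuous_const.add (𝔠.subtype.continuous_of_finiteDimensional.comp continuous_snd)
  have h1 : (fun p : ↥𝔪 × ↥𝔠 => (1 : Matrix n n F) + (p.1 : Matrix n n F)) ⁻¹' (Units.val '' W) ∈ 𝓝 (0 : ↥𝔪 × ↥𝔠) :=
    hc1.continuousAt.preimage_mem_nhds (by simpa only [Prod.fst_zero, ZeroMemClass.coe_zero, add_zero, Units.val_one] using hWm)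
  have h2 : (fun p : ↥𝔪 × ↥𝔠 => (γ : Matrix n n F) + (p.2 : Matrix n n F)) ⁻¹' (Units.val '' O) ∈ 𝓝 (0 : ↥𝔪 × ↥𝔠) :=
    hc2.continuousAt.preimage_mem_nhds (by simpa only [Prod.snd_zero, ZeroMemClass.coe_zero, add_zero] using hOm)
  have hS := e.image_mem_nhds h0 (inter_mem (e.open_source.mem_nhds h0) (inter_mem h1 h2))
  have he0 : e 0 = ((γ : GL n F) : Matrix n n F) := by
    rw [he]; simp only [Prod.fst_zero, Prod.snd_zero, ZeroMemClass.coe_zero, add_zero, Ring.inverse_one, mul_one, one_mul]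
  rw [he0] at hS
  -- pull back along the open embedding `GL_n(F) ↪ M_n(F)`
  rw [hemb.nhds_eq_comap]
  refine ⟨_, hS, ?_⟩
  rintro g ⟨p, ⟨-, hpW, hpO⟩, hpg⟩
  obtain ⟨x, hxW, hx⟩ := hpW
  obtain ⟨t, htO, ht⟩ := hpO
  have hx' : (x : Matrix n n F) = 1 + (p.1 : Matrix n n F) := hx
  have ht' : (t : Matrix n n F) = (γ : Matrix n n F) + (p.2 : Matrix n n F) := ht
  have hcomm : (γ : Matrix n n F) * ((γ : Matrix n n F) + (p.2 : Matrix n n F)) = ((γ : Matrix n n F) + (p.2 : Matrix n n F)) * (γ : Matrix n n F) := by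
    have h2 : (γ : Matrix n n F) * (p.2 : Matrix n n F) - (p.2 : Matrix n n F) * (γ : Matrix n n F) = 0 := by
      have := LinearMap.mem_ker.1 p.2.2
      rwa [LinearMap.sub_apply, LinearMap.mulLeft_apply, LinearMap.mulRight_apply] at this
    rw [mul_add, add_mul, sub_eq_zero.1 h2]
  refine ⟨x, hxW, t, ?_, htO, ?_⟩
  · rw [Subgroup.mem_centralizer_iff]
    rintro _ rfl
    exact Units.ext (by rw [Units.val_mul, Units.val_mul, ht', hcomm])
  · apply Units.ext
    rw [Units.val_mul, Units.val_mul, ← hpg, he, ← hx', ← ht', Ring.inverse_unit]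

end GLn

/-! ## §2 `U_N(H)(L⁺_v)` at a place split in `L` -/

section SplitPlace

open NumberField IsDedekindDomain Literature.NumberTheory.Rogawski1990 Literature.NumberTheory.Automorphic Literature.NumberTheory.Automorphic.UnitaryGroup

variable (L : Type) [Field L] [NumberField L] [IsCMField L] {N : ℕ} (H : Matrix (Fin N) (Fin N) L) {v : HeightOneSpectrum (𝓞 ↥(maximalRealSubfield L))}

/-- **SMALL CONJUGATES OF NEARBY TORUS POINTS FORM A NEIGHBOURHOOD OF A REGULAR `γ₀ ∈ U_N(H)(L⁺_v)` AT A SPLIT PLACE** (`H` hermitian with `det H` a unit, `w ∣ v` with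
`w̄ ≠ w`, every `N`): for every neighbourhood `W` of `1` and `O` of `γ₀`, `{x t x⁻¹ : x ∈ W, t ∈ Z(γ₀), t ∈ O} ∈ 𝓝 γ₀` — §1 transported along ★ `localSplitEquiv :
U(H)(L⁺_v) ≃ₜ* GL_N(L_w)`. [cite: HarishChandra1970, Part I §3 Lemma 20] [cite: Rogawski1990, §3.1 p. 19] -/
theorem conj_torus_mem_nhds_of_isRegularElt_split (hH : (H.map (cmConjRingHom L))ᵀ = H) (hHd : IsUnit H.det)
    (w : PlacesOver L v) (hw : IsCMField.complexConj L • w.1 ≠ w.1)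
    (γ₀ : (cmDatum L N H).Local v) (hγ₀ : IsRegularElt (γ₀.val : GL (Fin N) (LocalRing L v)))
    {W : Set ((cmDatum L N H).Local v)} (hW : W ∈ 𝓝 (1 : (cmDatum L N H).Local v)) {O : Set ((cmDatum L N H).Local v)} (hO : O ∈ 𝓝 γ₀) :
    {g : (cmDatum L N H).Local v | ∃ x ∈ W, ∃ t : ↥(Subgroup.centralizer ({γ₀} : Set ((cmDatum L N H).Local v))),
      (t : (cmDatum L N H).Local v) ∈ O ∧ g = x * (t : (cmDatum L N H).Local v) * x⁻¹} ∈ 𝓝 γ₀ := by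
  classical
  letI : NontriviallyNormedField (w.1.adicCompletion L) := Valued.toNontriviallyNormedField (w.1.adicCompletion L) (WithZero (Multiplicative ℤ))
  haveI : CharZero (w.1.adicCompletion L) := charZero_of_injective_algebraMap (algebraMap L _).injective
  let ψ : (cmDatum L N H).Local v ≃ₜ* GL (Fin N) (w.1.adicCompletion L) :=
    localSplitEquiv (IsCMField.complexConj L) H (IsCMField.complexConj_ne_one L)
      ((map_cmConjRingHom_eq_map_complexConj L H) ▸ hH) w hw (isUnit_placeForm_of_isUnit_det hHd w.1)
  -- regularity of the `w`-component
  have hsep : (((ψ γ₀ : GL (Fin N) (w.1.adicCompletion L)) : Matrix (Fin N) (Fin N) (w.1.adicCompletion L)).charpoly).Separable := by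
    have h := (Literature.Algebra.Polynomial.separable_iff_forall_map_evalRingHom _).1 hγ₀ w
    rw [← Matrix.charpoly_map] at h
    exact h
  -- §1 in `GL_N(L_w)` at `ψ γ₀` with the transported neighbourhoods
  have hW' : ψ '' W ∈ 𝓝 (1 : GL (Fin N) (w.1.adicCompletion L)) := by
    rw [← map_one ψ]; exact ψ.toHomeomorph.isOpenEmbedding.image_mem_nhds.2 hW
  have hO' : ψ '' O ∈ 𝓝 (ψ γ₀) := ψ.toHomeomorph.isOpenEmbedding.image_mem_nhds.2 hO
  have h := conj_centralizer_mem_nhds_gl (ψ γ₀) hsep hW' hO'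
  have hback := ψ.continuous.continuousAt.preimage_mem_nhds h
  refine mem_of_superset hback ?_
  rintro g ⟨x', ⟨x, hxW, rfl⟩, t', ht', ⟨t, htO, rfl⟩, hg⟩
  have htc : t ∈ Subgroup.centralizer ({γ₀} : Set ((cmDatum L N H).Local v)) := by
    rw [Subgroup.mem_centralizer_iff] at ht' ⊢
    rintro _ rfl
    exact ψ.injective (by rw [map_mul, map_mul]; exact ht' _ rfl)
  refine ⟨x, hxW, ⟨t, htc⟩, htO, ψ.injective ?_⟩
  rw [map_mul, map_mul, map_inv]
  exact hg

end SplitPlace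

end Summit.HodgeConjecture.HodgeConjecture.Cruxes.H413.K2E3RegularConjugationOpenSplit

end
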